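import Mathlib
import Summits.QuantumFields.BalabanUV.Beta.UnitLatticeOmegaBoxLocal
import Summits.QuantumFields.BalabanUV.Beta.UnitLatticeProfiles

/-!
# `Summit.QuantumFields.BalabanUV.Beta.UnitLatticeOmegaBoxEnd` — A3-loc-ω ON A BOX OF `ℤ^ν`, THE END WITH NUMBERS ONLY:
# `UnitLatticeOmegaBoxLocal.termSum_box_of_pieceMaj` with its two lattice profiles DISCHARGED (`UnitLatticeProfiles`) for
# INJECTIVELY embedded sites — the hypothesis list of the Ω hand-off is now, verbatim: ONE localised piece bound (rows +
# columns), ONE global coercivity datum, row-locality in cells, the near convention, and closed-form numeric inequalities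

HONEST FRAMING (page 1 of everything in this cell).  Discharging `FlowStep.BetaPertH` would make Bałaban's ultraviolet
stability UNCONDITIONAL — a constructive-QFT result; NOT the continuum limit, NOT the Clay problem.  This module
discharges nothing of `BetaPertH`; [folklore] bookkeeping, kernel-checked (unit `b2b-balaban-beta-d4-p3`, road P3, gen 5;
skeleton v1.12 §7.9).  THE RESIDUAL OF RIDER (ρ3) ON ROAD P3, EXACTLY (what a NODE-O.2 instance must supply to get
`(1 + Σ_ω K_ω)⁻¹` as the s ≡ 1 value of volume-free (2.16)-currency row data on a box-embedded unit lattice):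
(i) `hT`, `hTc` — `Σ_l (Σ_ω e^{(κ₁+κ₂)#cellsOf ω}‖K_ω(k,l)‖)e^{κ⁺ supDist(k,l)} ≤ ρ` and its column twin [= (T3) over
NODE O.2 in the row owner's `pieceMaj` currency; NOT moved by this lineage]; (ii) `hRe` — `γ‖z‖² ≤ Re z^*(1 + Σ_ωK_ω)z`
[(I4): PSD, γ = 1; (I3): G-B9-15; NOT moved]; (iii) `hKcells` — the pieces are row-local in their cells [by construction
for pieces regrouped by cell set]; (iv) `hnear` — every piece with fewer than `m₀` cells is «near» every cube [a
definition]; (v) NUMBERS: `0 < ν`, `0 < M`, `8M ≤ M_d`, `0 ≤ κ`, `0 < κ₁`, `0 ≤ κ₂`, `κ′ := κ + κ₁2^ν/(2M) < κ_c < κ⁺`,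
`κ_c·ρ·L₁⋆ < γ′ := γ − e^{−(κ₁+κ₂)m₀}(ρ + ρ_c)/2` and `ρ_Ω⋆ < 1`, where `L⋆ := (2(1 − e^{−(κ_c−κ′)/ν})⁻¹)^ν`,
`L₁⋆ := (e(κ⁺−κ_c)/2)⁻¹(2(1 − e^{−((κ⁺−κ_c)/2)/ν})⁻¹)^ν`, `ρ_Ω⋆ := (γ′ − κ_cρL₁⋆)⁻¹L⋆·((2·2^ν/(2M/(νπ)))·ρ/(e(κ⁺−κ′))
+ 2^ν e^{−κ₂m₀}ρ)` — all closed-form in (ν, M, κ, κ₁, κ₂, κ_c, κ⁺, ρ, ρ_c, γ, m₀): «M large, m₀ large, ρ of order one»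
(R1∕R25 in our letters).  Nothing of Bałaban's operators is instantiated; readiness width 0 unchanged; D4 DISCHARGE NO DATE;
NOT summit progress.
HONEST DEPENDENCY: continuum YM on T⁴ ⇐ BetaPertH ∧ nine spine estimates (0/9 proved); BetaPertH ⇐
(D1) ∧ (D4) ∧ CAP+tail; G-an2-4 gates asym, D1 and NE2/3/4.

CITATION (locator only).  [II] = T. Bałaban, Commun. Math. Phys. **116**, 1–22 (1988) [Balaban1988RG2Cluster], p. 13 after
(2.7), (1.11) p. 5; [13] = T. Bałaban, Commun. Math. Phys. **99**, 389–434 (1985) [Balaban1985BackgroundPropagators],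
Thm 3.10 (3.108) p. 416, p. 422.

CONTENTS (0 sorry).  **`termSum_box_end`** and a non-vacuity example.
-/

open scoped BigOperators Matrix
open Finset Matrix Metric Real

namespace Summit.QuantumFields.BalabanUV.Beta.UnitLatticeOmegaBoxEnd

open Summit.QuantumFields.BalabanUV.Beta.UnitLatticeWalkInversion
open Summit.QuantumFields.BalabanUV.Beta.UnitLatticeTubeCount (supDist supDistOn)
open Summit.QuantumFields.BalabanUV.Beta.UnitLatticePartition (hPart EPart)
open Summit.QuantumFields.BalabanUV.Beta.UnitLatticeWalkInversionDecay (locInv)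
open Summit.QuantumFields.BalabanUV.Beta.UnitLatticeOmegaTerms
open Summit.QuantumFields.BalabanUV.Beta.UnitLatticeOmegaRowData
open Summit.QuantumFields.BalabanUV.Beta.UnitLatticeOmegaBox
open Summit.QuantumFields.BalabanUV.Beta.UnitLatticeOmegaBoxLocal
open Summit.QuantumFields.BalabanUV.Beta.UnitLatticeProfiles (profile_zero_le profile_one_le)
open Summit.QuantumFields.BalabanUV.Beta.AnalyticWalkSum216 (termSum)
open Summit.QuantumFields.BalabanUV.Beta.AnalyticWalkSum216RowResolvent (pieceMaj)
open Literature.MathematicalPhysics.QuantumFieldTheory.Balaban1983to89.B5Prop11Lower (nsq)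

noncomputable section

variable {Y : Type*} [Fintype Y] [DecidableEq Y] {Ω : Type*} [Fintype Ω] [DecidableEq Ω] {ν q : ℕ}

/-- **THE END ON A BOX, NUMBERS ONLY.**  As `UnitLatticeOmegaBoxLocal.termSum_box_of_pieceMaj`, for INJECTIVE sites `e`, with
the profiles `L := L⋆(κ_c − κ′)` and `L₁ := L₁⋆(κ⁺ − κ_c)` of `UnitLatticeProfiles` plugged in (module docstring (v)).
[cite: Balaban1988RG2Cluster, p.13 after (2.7)] -/
theorem termSum_box_end (hν : 0 < ν) {M Md : ℕ} (hM : 0 < M) (hMd : 8 * M ≤ Md) (e : Y → (Fin ν → ℤ))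
    (he : Function.Injective e) (hbox : ∀ y i, 0 ≤ e y i ∧ e y i ≤ q * M)
    {κ κ₁ κ₂ κp ρ ρc m₀ γ κc : ℝ} (hκ : 0 ≤ κ) (hκ₁ : 0 < κ₁) (hκ₂ : 0 ≤ κ₂)
    (K : Ω → Matrix Y Y ℂ) (cellsOf : Ω → Finset (Fin ν → ℤ))
    (hKcells : ∀ ω k l, K ω k l ≠ 0 → cellAt Md e k ∈ cellsOf ω)
    (near : (Fin ν → Fin (q + 1)) → Finset Ω) (hnear : ∀ b ω, ω ∉ near b → m₀ ≤ (cellsOf ω).card)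
    (hκc : κ + κ₁ * ((2 ^ ν : ℕ) / (2 * (M : ℝ))) < κc) (hκcp : κc < κp)
    (hT : ∀ k, ∑ l, (∑ ω, pieceMaj (κ₁ + κ₂) K cellsOf ω k l) * Real.exp (κp * supDistOn e k l) ≤ ρ)
    (hTc : ∀ l, ∑ k, (∑ ω, pieceMaj (κ₁ + κ₂) K cellsOf ω k l) * Real.exp (κp * supDistOn e k l) ≤ ρc)
    (hRe : ∀ z : Y → ℂ, γ * nsq z ≤ (star z ⬝ᵥ ((1 + Ktot K) *ᵥ z)).re)
    (hm : κc * ρ * ((Real.exp 1 * ((κp - κc) / 2))⁻¹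
          * (2 * (1 - Real.exp (-((κp - κc - (κp - κc) / 2) / ν)))⁻¹) ^ ν)
        < γ - Real.exp (-((κ₁ + κ₂) * m₀)) * (ρ + ρc) / 2)
    (hρ : (γ - Real.exp (-((κ₁ + κ₂) * m₀)) * (ρ + ρc) / 2
          - κc * ρ * ((Real.exp 1 * ((κp - κc) / 2))⁻¹
            * (2 * (1 - Real.exp (-((κp - κc - (κp - κc) / 2) / ν)))⁻¹) ^ ν))⁻¹
        * (2 * (1 - Real.exp (-((κc - (κ + κ₁ * ((2 ^ ν : ℕ) / (2 * (M : ℝ))))) / ν)))⁻¹) ^ ν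
        * (2 * (2 : ℝ) ^ ν / (2 * (M : ℝ) / (ν * π))
          * ((Real.exp 1 * (κp - (κ + κ₁ * ((2 ^ ν : ℕ) / (2 * (M : ℝ))))))⁻¹ * ρ)
          + (2 : ℝ) ^ ν * Real.exp (-(κ₂ * m₀)) * ρ) < 1) (Δ₀ : Fin ν → ℤ) :
    termSum (decFamilyΩ (cellAt Md e) (EPart M q e) (domOf Md e cellsOf) (hPart M q e) K near
      (fun b => locInv (Knear K near b) (EPart M q e) b) (fun _ => (1 : ℂ)) Δ₀) 1 = (1 + Ktot K)⁻¹ := by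
  have hb : 0 < (κp - κc) / 2 := by linarith
  have hab : (κp - κc) / 2 < κp - κc := by linarith
  have hL0 : (0 : ℝ) ≤ (2 * (1 - Real.exp (-((κc - (κ + κ₁ * ((2 ^ ν : ℕ) / (2 * (M : ℝ))))) / ν)))⁻¹) ^ ν := by
    refine pow_nonneg (mul_nonneg zero_le_two (inv_nonneg.2 (sub_nonneg.2 ?_))) ν
    refine Real.exp_le_one_iff.2 (neg_nonpos.2 (div_nonneg (by linarith) (Nat.cast_nonneg ν)))
  have hκ'0 : 0 ≤ κ + κ₁ * ((2 ^ ν : ℕ) / (2 * (M : ℝ))) := by positivity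
  exact termSum_box_of_pieceMaj hν hM hMd e hbox hκ hκ₁ hκ₂ K cellsOf hKcells near hnear (hκc.trans hκcp) hT hTc hRe
    (hκ'0.trans hκc.le) (fun i => profile_one_le hν e he hb hab i)
    (fun i => profile_zero_le hν e he (sub_pos.2 hκc) i) hL0 hm hρ Δ₀

end

end Summit.QuantumFields.BalabanUV.Beta.UnitLatticeOmegaBoxEnd
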